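import Summits.ResolutionOfSingularities.ResolutionOfSingularities.Theorems.WildPurityPurityTransferStubFormsSpan
import Literature.NumberTheory.GaloisCohomology.InverseCartierOperator
import HarnessLib

/-!
# Kato's `H^{n+1}_p(K)` through forms is `coker(γ − 1)`, unconditionally for fields
# (crux `WildPurity.PurityTransfer`, stmt-ResolutionOfSingularities-17142, lead c1)

The de Rham-side group `KatoCohomologyDeRham p K n := Ωⁿ_K ⧸ (exactForms K n ⊔ artinSchreierForms K p n)`
(`Literature/NumberTheory/GaloisCohomology/KatoCohomologyDifferentialForms.lean`) — the group in which the crux's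
one remaining named fact `GrosSuwa1988_purity_deRham` is stated — coincides with the PRINTED definition
`H^{n+1}_p(K) = coker(γ − 1 : Ωⁿ_K → Ωⁿ_K/Bⁿ_K)`, `γ` the inverse Cartier operator (Kato 1982 §1; Gille–Szamuely
2017, Thm. 9.2.4): the Literature theorem `mem_exactForms_sup_artinSchreierForms_iff`
(`InverseCartierOperator.lean`, where `γ = invCartierQuot p K n` is CONSTRUCTED) with its spanning hypothesis
discharged by the landed stub `stub_formsSpan` (the logarithmic forms span `Ωⁿ_K` for every field).  This closes
the route's standing "transcription risk" on the relation set of `H³_p` from the forms side, complementing the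
symbolic side (`BlochKato1986_symbolicPresentation_holds`).
-/

set_option linter.dupNamespace false

noncomputable section

universe u

open Literature.NumberTheory.GaloisCohomology

namespace Summit.ResolutionOfSingularities.ResolutionOfSingularities.Theorems.WildPurityPurityTransfer

/-- **`exactForms ⊔ artinSchreierForms = (γ − 1)⁻¹`, i.e. `KatoCohomologyDeRham p K n = coker(γ − 1)`, for every
field `K` of characteristic `p`**: a form `ω ∈ Ωⁿ_K` is killed in `KatoCohomologyDeRham p K n` iff its class modulo
exact forms is `γ η − η` for some `η`, `γ = invCartierQuot p K n` the inverse Cartier operator.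
[cite: GilleSzamuely2017, Thm. 9.2.4; Kato1982, §1] -/
theorem katoCohomologyDeRham_relations_eq_coker_invCartier (p : ℕ) [Fact p.Prime] (K : Type u) [Field K]
    [CharP K p] (n : ℕ) (ω : ⋀[K]^n (Ω[K⁄ℤ])) :
    ω ∈ exactForms K n ⊔ artinSchreierForms K p n ↔
      ∃ η : ⋀[K]^n (Ω[K⁄ℤ]), ((ω : (⋀[K]^n (Ω[K⁄ℤ])) ⧸ exactForms K n)) =
        invCartierQuot p K n η - ((η : ⋀[K]^n (Ω[K⁄ℤ])) : (⋀[K]^n (Ω[K⁄ℤ])) ⧸ exactForms K n) :=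
  mem_exactForms_sup_artinSchreierForms_iff p K n (stub_formsSpan K n) ω

end Summit.ResolutionOfSingularities.ResolutionOfSingularities.Theorems.WildPurityPurityTransfer

end
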